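import Summits.AnomalousDissipation.AnomalousDissipation.Theses.TaylorCertificates

/-!
# Line `bernoulli-head-signed-work-family` on the crux `TaylorCertificates.SteadyStatesLoudBounded`
(stmt-AnomalousDissipation-13038, rank 3) — crux-plan seat, round 1, 2026-08-16

**THIS IS NOT A CONCLUDING SKELETON (verdict: no-skeleton).** No `stub_*` is declared and no theorem of
this file concludes the route decl `SteadyStatesLoudBounded` without hypotheses; `ledger skeleton check`
must NOT be run on it. What the file is: the typed, `lean check`ed record behind the verdict, plus the two
provable-now lemmas of the idea typed over TREE VOCABULARY ONLY so that any later line can land them as tools.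

The crux (read back from the route file, rev 12): ONE smooth divergence-free mean-zero force `f` on `T³` and
`ε₀, E, ν₀ > 0` such that for every `ν ∈ (0, ν₀)` EVERY smooth divergence-free mean-zero steady weak state
`u` of `NS_ν(f)` (tested on smooth divergence-free mean-zero `w`, pressure-free) is LOUD
(`ε₀ ≤ ν‖∇u‖²`, FLOOR) and BOUNDED (`∫|u|² ≤ E`, CEILING).

The idea (ideator 2, card body NOT readable in this jail — see the line card; abstract + the three triage
re-derivations + this seat's re-derivation): the Korobkov–Pileckas–Russo total head `Φ = p + |u|²/2` of a
classical steady state, WITH THE FORCE KEPT, satisfies `∇Φ = νΔu − (u·∇)u + f + ∇(|u|²/2)` (Bernoulli form of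
the steady equation), `u·∇Φ = f·u + ν u·Δu`, `u·∇Φ − νΔΦ = f·u − ν|ω|²`, hence for every weight `g = G′`:
`ν∫g′(Φ)|∇Φ|² + ν∫g(Φ)|ω|² = ∫g(Φ) f·u` — SIGNED for `g, g′ ≥ 0` ("signed work family"); `g = 1_{Φ<k}`:
"low head regions are net dissipators".

* §0 the crux unbundled (`IsTest`, `IsCruxSteady`, `SteadyFloor`, `SteadyCeiling`) and the elementary
  `steadyStatesLoudBounded_of_floor_of_ceiling` (PROVED).
* §1 the objects of the card typed over tree vocabulary: `IsHeadOf` (Bernoulli form), the two provable-now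
  lemmas `HeadExists` (= pressure recovery, Disproof §11 `isSteady_iff_exists_pressure` + `Φ := p + |u|²/2`)
  and `HeadWorkIdentity` (the card's `HeadWeightedWorkIdentity`, smooth weights, vorticity written as
  `Σᵢ‖∂ᵢu‖² − Σᵢⱼ ∂ᵢuⱼ ∂ⱼuᵢ = |ω|²`), with its corollaries `SignedHeadWork` / `LowHeadNetDissipator`.
* §2 the WOULD-BE composition, typed and PROVED as logic with EXPLICIT hypotheses (so it cannot be registered
  by accident): `SteadyStatesLoudBounded` ⇐ `Floor f ∧ NoLaminarRung f ∧ NoSublaminarFat f` for an admissible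
  `f` (the rate trichotomy every CEILING line shares). THE POINT OF THE VERDICT: the head lemmas of §1 do not
  and cannot enter this composition as consumed hypotheses — §3.
* §3 WHY NO SKELETON, typed: (V1) `signedFamily_void_of_free_head` (PROVED): once `Φ` is decoupled from `u`
  the whole signed family is satisfied by EVERY field (take `Φ := s = f·u − ν|ω|²`: `∫g(s)s ≥ 0` for every
  monotone `g`), so the family's content is exactly the coupling `∇Φ = …`, i.e. the steady equation itself —
  no top-level stub can consume it (it is either derivable inside that stub or void); (V2) `HeadBlowdownData`
  — what a sub-laminar fat sequence hands to a strong `L²` blow-down profile (`∫g(B) f·U ≥ 0`) — is satisfied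
  by every OBLIQUE SHEAR profile (`B = φ²/2`, planar means of `f·d` vanish off the support lines of `f̂`; these
  profiles exist kinematically for EVERY force and are the BN1 warm-branch enemy) and by every Beltrami profile
  (`B ≡ const`): a 'profile rigidity' stub is refuted in minutes by a shear witness, and excluding shear
  blow-downs is `C_warm` (line kelvin-batchelor-work-coboundary), not this idea; (V3) FLOOR: a smooth quiet
  Euler point `v` of `f` satisfies every head constraint EXACTLY (`∫_{B_v>k} f·v = ∫div((B_v−k)₊v) = 0`), so
  the family has no floor mechanism; the floor would be imported wholesale (line 2 of the panel: Lamb rigidity).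
  Hence every concluding composition through this idea is {Floor, NoLaminarRung (= FrustratedForces crux
  GPSteadySubGrashof territory, stmt-2978), NoSublaminarFat (= the BN1 question)} + two unused decorations:
  bookkeeping in costume. The idea survives as a TOOL of the merged CEILING line (triage ×3: merge with
  bernoulli-superlevel-blowdown; bite = integrable non-shear non-Beltrami blow-down profiles only).

Disproof.lean (cdisprove v1–v5, evidence notes; file itself not mounted here) honoured: `cruxWithoutNuPos_false`
— `ν > 0` is load-bearing in §1 exactly where the identity is divided by `ν` / signed (`HeadWorkIdentity` keeps
`ν` as a factor and claims no sign for `ν ≤ 0`); `cruxWithoutNuLt_false` — nothing here is claimed for large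
`ν`; §11 `isSteady_iff_exists_pressure` is what `HeadExists` restates in Bernoulli form (credit: cdisprove);
`not_body_neg_laplacian_of_euler` / `not_body_unidirectional` / `not_body_twoHalf_planar` — no force is pinned in
this file, and the laminar branches they exhibit are instances of the LAMINAR RUNG of §2 (`NoLaminarRung` false
for those forces), consistent; `body_smul_iff` — all statements here are homogeneous under the scaling. No
statement of this file asserts the crux, a floor or a ceiling for any force, so none is an instance of a
refuted statement (`ledger negatives`: 13037 TaylorCertificatePair, 2979/2984 drift data, 2859 DebrisQuanta).
-/

noncomputable section

set_option linter.dupNamespace false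
set_option linter.unusedVariables false

open MeasureTheory
open scoped ContDiff

namespace Summit.AnomalousDissipation.AnomalousDissipation.Cruxes.SteadyStatesLoudBounded.BernoulliHeadSignedWorkFamily

open Literature.Analysis.FunctionSpaces
open Summit.AnomalousDissipation.AnomalousDissipation.Theses.TaylorCertificates

/-- Local notation: the flat unit 3-torus. -/
local notation "𝕋³" => UnitAddTorus (Fin 3)
/-- Local notation: velocity values. -/
local notation "E³" => EuclideanSpace ℝ (Fin 3)

/-! ## §0 The crux unbundled -/

/-- The smooth, divergence-free, mean-zero class (states, forces and test fields of the crux). -/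
def IsTest (w : 𝕋³ → E³) : Prop :=
  Torus.IsSmooth w ∧ Torus.IsDivFree w ∧ Torus.HasZeroMean w

/-- `u` is a steady weak state of `NS_ν(f)` in the crux's exact (pressure-free) sense. -/
def IsCruxSteady (ν : ℝ) (f u : 𝕋³ → E³) : Prop :=
  IsTest u ∧ ∀ w : 𝕋³ → E³, IsTest w →
    ∫ x, inner ℝ (ν • Torus.laplacian u x - Torus.convect u u x + f x) (w x) = 0

/-- FLOOR clause of the crux for the force `f` with constants `(ε₀, ν₀)`. -/
def SteadyFloor (f : 𝕋³ → E³) (ε₀ ν₀ : ℝ) : Prop :=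
  ∀ ν : ℝ, 0 < ν → ν < ν₀ → ∀ u : 𝕋³ → E³, IsCruxSteady ν f u → ε₀ ≤ ν * Torus.gradNormSq u

/-- CEILING clause of the crux for the force `f` with constants `(E, ν₀)`. -/
def SteadyCeiling (f : 𝕋³ → E³) (E ν₀ : ℝ) : Prop :=
  ∀ ν : ℝ, 0 < ν → ν < ν₀ → ∀ u : 𝕋³ → E³, IsCruxSteady ν f u → (∫ x, ‖u x‖ ^ 2) ≤ E

/-- Elementary (PROVED): an admissible force carrying a FLOOR and a CEILING (possibly with different
viscosity thresholds) witnesses the crux. Every line for this crux ends here; the content is upstream. -/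
theorem steadyStatesLoudBounded_of_floor_of_ceiling (f : 𝕋³ → E³) (hf : IsTest f)
    {ε₀ E ν₁ ν₂ : ℝ} (hε₀ : 0 < ε₀) (hν₁ : 0 < ν₁) (hν₂ : 0 < ν₂)
    (hF : SteadyFloor f ε₀ ν₁) (hC : SteadyCeiling f E ν₂) :
    SteadyStatesLoudBounded := by
  obtain ⟨hfs, hfd, hfz⟩ := hf
  refine ⟨f, hfs, hfd, hfz, ε₀, E, min ν₁ ν₂, hε₀, lt_min hν₁ hν₂, ?_⟩
  intro ν hν hνlt u hus hud huz hweak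
  have hst : IsCruxSteady ν f u :=
    ⟨⟨hus, hud, huz⟩, fun w hw => hweak w hw.1 hw.2.1 hw.2.2⟩
  exact ⟨hF ν hν (lt_of_lt_of_le hνlt (min_le_left _ _)) u hst,
    hC ν hν (lt_of_lt_of_le hνlt (min_le_right _ _)) u hst⟩

/-! ## §1 The objects of the card, over tree vocabulary -/

/-- **Bernoulli form of the classical steady equation**: `Φ` is a (total, Bernoulli) HEAD of the triple
`(ν, f, u)` — `Φ` is smooth and `∇Φ = νΔu − (u·∇)u + f + ∇(|u|²/2)` pointwise. For a classical steady state
with pressure `p` (`(u·∇)u + ∇p = νΔu + f`) this is `Φ = p + |u|²/2` up to a constant; conversely a head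
gives the pressure `p := Φ − |u|²/2`. (Korobkov–Pileckas–Russo's "total head pressure", force kept.) -/
def IsHeadOf (ν : ℝ) (f u : 𝕋³ → E³) (Φ : 𝕋³ → ℝ) : Prop :=
  Torus.IsSmooth Φ ∧ ∀ x : 𝕋³,
    Torus.gradient Φ x =
      ν • Torus.laplacian u x - Torus.convect u u x + f x + Torus.gradient (fun y => ‖u y‖ ^ 2 / 2) x

/-- **L1 `HeadExists` (provable now, size M; tree vocabulary only).** Every smooth divergence-free state
`u` solving the crux's pressure-free weak form for a smooth mean-zero force `f` has a smooth head.
Proof route: the residual `R = νΔu − (u·∇)u + f` is smooth with zero mean (`∫(u·∇)u = 0`, `∫f = 0`); the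
smooth Helmholtz decomposition `R = v + ∇q` (tree: `Torus.smooth_helmholtz_holds`) has `v` smooth,
divergence-free and mean-zero, so `v` is an admissible test field and `0 = ∫⟪R,v⟫ = ‖v‖²`, i.e. `R = ∇q`;
put `Φ := q + |u|²/2`. (= `isSteady_iff_exists_pressure` of the crux's Disproof.lean §11, cdisprove v5,
rewritten in Bernoulli form; mean-zero `u` and `div f = 0` are not needed.) -/
def HeadExists : Prop :=
  ∀ (ν : ℝ) (f u : 𝕋³ → E³),
    Torus.IsSmooth f → Torus.HasZeroMean f → Torus.IsSmooth u → Torus.IsDivFree u →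
    (∀ w : 𝕋³ → E³, Torus.IsSmooth w → Torus.IsDivFree w → Torus.HasZeroMean w →
      ∫ x, inner ℝ (ν • Torus.laplacian u x - Torus.convect u u x + f x) (w x) = 0) →
    ∃ Φ : 𝕋³ → ℝ, Torus.IsSmooth Φ ∧ ∀ x : 𝕋³,
      Torus.gradient Φ x =
        ν • Torus.laplacian u x - Torus.convect u u x + f x + Torus.gradient (fun y => ‖u y‖ ^ 2 / 2) x

/-- **L2 `HeadWorkIdentity` — the card's `HeadWeightedWorkIdentity` with smooth weights (provable now,
size M; tree vocabulary only; exact at every `ν`, no coarea / Sard needed).** For smooth divergence-free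
`u`, smooth divergence-free `f`, a head `Φ` of `(ν, f, u)` and a smooth weight `g` (`= G′`; smooth so that the
tree's `IsSmooth`-only integration-by-parts facts apply verbatim — `C¹` suffices on paper):
`ν ∫ g′(Φ)|∇Φ|² + ν ∫ g(Φ)·(Σᵢ‖∂ᵢu‖² − Σᵢⱼ ∂ᵢuⱼ∂ⱼuᵢ) = ∫ g(Φ) ⟪f, u⟫`, where the bracket is `|ω|²`
(`= |∇u|² − tr((∇u)²)`; index convention `(∂ᵢu)ⱼ = Torus.partialDeriv i u x j`).
Derivation (re-checked by this seat and by all three triagers): (1) `⟪u,(u·∇)u⟫ = u·∇(|u|²/2)` gives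
`u·∇Φ = ⟪f,u⟫ + ν⟪Δu,u⟫` pointwise; (2) `∫ g(Φ) u·∇Φ = ∫ u·∇G(Φ) = 0` (`div u = 0`), so
`∫ g(Φ)⟪f,u⟫ = −ν∫ g(Φ)⟪Δu,u⟫` (TRANSPORT FORM, every `g`); (3) one integration by parts:
`−∫g(Φ)⟪u,Δu⟫ = ∫g(Φ)|∇u|² + ∫g′(Φ) ∇Φ·∇(|u|²/2)`, and `∇(|u|²/2) = ∇Φ − (νΔu − (u·∇)u + f)` with
`∫∇(g(Φ))·(νΔu − (u·∇)u + f) = −∫g(Φ) div((u·∇)u) = −∫ g(Φ) tr((∇u)²)` (`div Δu = 0`, `div f = 0`). -/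
def HeadWorkIdentity : Prop :=
  ∀ (ν : ℝ) (f u : 𝕋³ → E³) (Φ : 𝕋³ → ℝ) (g : ℝ → ℝ),
    Torus.IsSmooth f → Torus.IsDivFree f → Torus.IsSmooth u → Torus.IsDivFree u →
    IsHeadOf ν f u Φ → ContDiff ℝ ∞ g →
    ν * (∫ x, deriv g (Φ x) * ‖Torus.gradient Φ x‖ ^ 2) +
      ν * (∫ x, g (Φ x) *
        ((∑ i, ‖Torus.partialDeriv i u x‖ ^ 2) -
          ∑ i, ∑ j, (Torus.partialDeriv i u x) j * (Torus.partialDeriv j u x) i)) =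
      ∫ x, g (Φ x) * inner ℝ (f x) (u x)

/-- **Corollary `SignedHeadWork` (the "signed work family").** For `ν > 0` and a nondecreasing nonnegative
smooth weight `g`, the `g(Φ)`-weighted work of the force is at least the `g(Φ)`-weighted viscous dissipation,
in particular nonnegative: `ν∫g(Φ)|ω|² ≤ ∫g(Φ)⟪f,u⟫`. (Drop `ν∫g′|∇Φ|² ≥ 0` in L2; `|ω|² ≥ 0` pointwise is
`Σᵢ‖∂ᵢu‖² − tr((∇u)²) = ½Σᵢⱼ(∂ᵢuⱼ − ∂ⱼuᵢ)²`.) HERE `ν > 0` IS LOAD-BEARING (Disproof `cruxWithoutNuPos_false`: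
the reflection `u ↦ −u, ν ↦ −ν` flips the sign of the family). -/
def SignedHeadWork : Prop :=
  ∀ (ν : ℝ) (f u : 𝕋³ → E³) (Φ : 𝕋³ → ℝ) (g : ℝ → ℝ), 0 < ν →
    Torus.IsSmooth f → Torus.IsDivFree f → Torus.IsSmooth u → Torus.IsDivFree u →
    IsHeadOf ν f u Φ → ContDiff ℝ ∞ g → Monotone g → (∀ t, 0 ≤ g t) →
    ν * (∫ x, g (Φ x) *
        ((∑ i, ‖Torus.partialDeriv i u x‖ ^ 2) -
          ∑ i, ∑ j, (Torus.partialDeriv i u x) j * (Torus.partialDeriv j u x) i)) ≤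
      ∫ x, g (Φ x) * inner ℝ (f x) (u x)

/-- **Corollary `LowHeadNetDissipator` (the card's second first-lemma, smooth version).** For `ν > 0` and a
NONINCREASING nonnegative smooth weight `h` (a smoothed `1_{Φ<k}`), the work received by the low-head region is
at most the viscous dissipation there: `∫h(Φ)⟪f,u⟫ ≤ ν∫h(Φ)|ω|²` (L2 with `g = h`: the level term
`ν∫h′(Φ)|∇Φ|²` is `≤ 0`). Sharp-cutoff reading: `∫_{Φ<k} f·u = ν∫_{Φ<k}|ω|² − ν∫_{Φ=k}|∇Φ| dσ`. -/
def LowHeadNetDissipator : Prop :=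
  ∀ (ν : ℝ) (f u : 𝕋³ → E³) (Φ : 𝕋³ → ℝ) (h : ℝ → ℝ), 0 < ν →
    Torus.IsSmooth f → Torus.IsDivFree f → Torus.IsSmooth u → Torus.IsDivFree u →
    IsHeadOf ν f u Φ → ContDiff ℝ ∞ h → Antitone h → (∀ t, 0 ≤ h t) →
    (∫ x, h (Φ x) * inner ℝ (f x) (u x)) ≤
      ν * (∫ x, h (Φ x) *
        ((∑ i, ‖Torus.partialDeriv i u x‖ ^ 2) -
          ∑ i, ∑ j, (Torus.partialDeriv i u x) j * (Torus.partialDeriv j u x) i))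

/-- Bookkeeping (PROVED): the level term of L2 has the sign of `g′` — for an antitone weight the
integrand `h′(Φ)|∇Φ|²` is pointwise `≤ 0`, which is all `LowHeadNetDissipator` adds to L2. -/
theorem levelTerm_nonpos_of_antitone (Φ : 𝕋³ → ℝ) (h : ℝ → ℝ)
    (hanti : Antitone h) (x : 𝕋³) :
    deriv h (Φ x) * ‖Torus.gradient Φ x‖ ^ 2 ≤ 0 :=
  mul_nonpos_of_nonpos_of_nonneg hanti.deriv_nonpos (sq_nonneg _)

/-- PROVED: `SignedHeadWork` is a corollary of L2 (drop the level term `ν∫g′(Φ)|∇Φ|² ≥ 0`, `g` monotone,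
`ν > 0`). -/
theorem signedHeadWork_of_headWorkIdentity (hL2 : HeadWorkIdentity) : SignedHeadWork := by
  intro ν f u Φ g hν hf hfd hu hud hΦ hg hmono hg0
  have key := hL2 ν f u Φ g hf hfd hu hud hΦ hg
  have hA : 0 ≤ ∫ x, deriv g (Φ x) * ‖Torus.gradient Φ x‖ ^ 2 :=
    integral_nonneg fun x => mul_nonneg hmono.deriv_nonneg (sq_nonneg _)
  have hνA : 0 ≤ ν * ∫ x, deriv g (Φ x) * ‖Torus.gradient Φ x‖ ^ 2 := mul_nonneg hν.le hA
  linarith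

/-- PROVED: `LowHeadNetDissipator` is a corollary of L2 (the level term is `≤ 0` for an antitone weight). -/
theorem lowHeadNetDissipator_of_headWorkIdentity (hL2 : HeadWorkIdentity) : LowHeadNetDissipator := by
  intro ν f u Φ h hν hf hfd hu hud hΦ hh hanti hh0
  have key := hL2 ν f u Φ h hf hfd hu hud hΦ hh
  have hA : (∫ x, deriv h (Φ x) * ‖Torus.gradient Φ x‖ ^ 2) ≤ 0 :=
    integral_nonpos fun x => levelTerm_nonpos_of_antitone Φ h hanti x
  have hνA : ν * (∫ x, deriv h (Φ x) * ‖Torus.gradient Φ x‖ ^ 2) ≤ 0 :=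
    mul_nonpos_of_nonneg_of_nonpos hν.le hA
  linarith

/-! ## §2 The would-be composition: the rate trichotomy (typed, PROVED logic; explicit hypotheses) -/

/-- NO LAMINAR RUNG for `f` over the crux's smooth steady class: steady states are `o(ν⁻¹)` in `L²`,
`ν²∫|u|² → 0` uniformly (the smooth-class form of FrustratedForces' crux `GPSteadySubGrashof`, stmt-2978, for
a general force; its blow-down profiles are `H¹` steady Euler states POSITIVELY RESONANT with `f`,
`(f,U) ≥ 4π²√c‖U‖²` — FrustratedForces support `LaminarLimitCompactness`; on this rung the head family L2
passes to the limit as weighted resonance inequalities `∫g(B)⟪f,U⟫ ≥ √c(∫g(B)|curl U|² + ∫g′(B)|∇B|²)`,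
genuinely signed but not what excludes the rung — cokernel/Livšic data do). False for every force whose
gravest component is a steady Euler profile (Disproof §9 `not_body_neg_laplacian_of_euler`, Marchioro). -/
def NoLaminarRung (f : 𝕋³ → E³) : Prop :=
  ∀ c : ℝ, 0 < c → ∃ ν₁ : ℝ, 0 < ν₁ ∧ ∀ ν : ℝ, 0 < ν → ν < ν₁ →
    ∀ u : 𝕋³ → E³, IsCruxSteady ν f u → ν ^ 2 * (∫ x, ‖u x‖ ^ 2) ≤ c

/-- NO SUB-LAMINAR FAT WINDOW for `f`: below some Grashof fraction `c/ν²` the steady states are `O(1)` —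
the window `(E₁, c/ν²)` of energies is empty for small `ν`. THIS is where the idea would act (KPR/Leray
reductio: normalise a fat sequence `U_n = u_n/√E_n`, pass the signed family to a blow-down profile) and where
it has no teeth (§3 (V2)): the window contains the BN1 warm branches `E ≍ ν^{-2/3}` riding invisible oblique
shear skeletons, whose profiles pass every head constraint. -/
def NoSublaminarFat (f : 𝕋³ → E³) : Prop :=
  ∃ c : ℝ, 0 < c ∧ ∃ (E₁ ν₂ : ℝ), 0 < ν₂ ∧ ∀ ν : ℝ, 0 < ν → ν < ν₂ →
    ∀ u : 𝕋³ → E³, IsCruxSteady ν f u → ν ^ 2 * (∫ x, ‖u x‖ ^ 2) ≤ c → (∫ x, ‖u x‖ ^ 2) ≤ E₁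

/-- PROVED logic: no laminar rung + no sub-laminar window ⇒ CEILING. -/
theorem steadyCeiling_of_noLaminarRung_of_noSublaminarFat (f : 𝕋³ → E³)
    (hR : NoLaminarRung f) (hS : NoSublaminarFat f) :
    ∃ (E ν₀ : ℝ), 0 < ν₀ ∧ SteadyCeiling f E ν₀ := by
  obtain ⟨c, hc, E₁, ν₂, hν₂, hwin⟩ := hS
  obtain ⟨ν₁, hν₁, hrung⟩ := hR c hc
  refine ⟨E₁, min ν₁ ν₂, lt_min hν₁ hν₂, fun ν hν hνlt u hu => ?_⟩
  exact hwin ν hν (lt_of_lt_of_le hνlt (min_le_right _ _)) u hu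
    (hrung ν hν (lt_of_lt_of_le hνlt (min_le_left _ _)) u hu)

/-- **The would-be composition (PROVED logic; conclusion = the crux BY NAME; the three rate statements and
admissibility enter as EXPLICIT hypotheses so that this is NOT a registrable skeleton).** For an admissible
force: FLOOR + no laminar rung + no sub-laminar fat window ⇒ `SteadyStatesLoudBounded`. The head lemmas of
§1 appear nowhere in it — §3 explains why they cannot. -/
theorem steadyStatesLoudBounded_of_trichotomy (f : 𝕋³ → E³) (hf : IsTest f)
    (hF : ∃ (ε₀ ν₁ : ℝ), 0 < ε₀ ∧ 0 < ν₁ ∧ SteadyFloor f ε₀ ν₁)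
    (hR : NoLaminarRung f) (hS : NoSublaminarFat f) :
    SteadyStatesLoudBounded := by
  obtain ⟨ε₀, ν₁, hε₀, hν₁, hfloor⟩ := hF
  obtain ⟨E, ν₀, hν₀, hceil⟩ := steadyCeiling_of_noLaminarRung_of_noSublaminarFat f hR hS
  exact steadyStatesLoudBounded_of_floor_of_ceiling f hf hε₀ hν₁ hν₀ hfloor hceil

/-! ## §3 Why no skeleton (typed) -/

/-- **(V1) The signed family is VOID once the head is decoupled from the field (PROVED).** For ANY
integrable `s` of zero mean (think `s = ⟪f,u⟫ − ν|ω|²`, the source of the head equation, whose mean vanishes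
by the energy identity) and ANY monotone weight `g`, `∫ g(s)·s ≥ 0`. So a field `u` together with the free
choice `Φ := s` satisfies every inequality `∫ g(Φ)(⟪f,u⟫ − ν|ω|²) ≥ 0` of the family: all information of the
family sits in the coupling `∇Φ = νΔu − (u·∇)u + f + ∇(|u|²/2)`, which IS the steady equation. Consequence
for skeleton design: a top-level stub that assumes the signed family (without the coupling) assumes nothing;
one that assumes the coupling can derive L2 internally — either way L1/L2 are not consumed by a composition. -/
theorem signedFamily_void_of_free_head {α : Type*} [MeasurableSpace α] (μ : Measure α)
    (s : α → ℝ) (g : ℝ → ℝ) (hg : Monotone g) (hs : Integrable s μ)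
    (hgs : Integrable (fun x => g (s x) * s x) μ) (h0 : ∫ x, s x ∂μ = 0) :
    0 ≤ ∫ x, g (s x) * s x ∂μ := by
  have hpt : ∀ x, g 0 * s x ≤ g (s x) * s x := by
    intro x
    rcases le_total 0 (s x) with h | h
    · exact mul_le_mul_of_nonneg_right (hg h) h
    · exact mul_le_mul_of_nonpos_right (hg h) h
  have h1 : ∫ x, g 0 * s x ∂μ ≤ ∫ x, g (s x) * s x ∂μ :=
    integral_mono (hs.const_mul (g 0)) hgs hpt
  rw [integral_const_mul, h0, mul_zero] at h1
  exact h1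

/-- (V1) specialised to the torus with Lebesgue measure, in the shape of the family: for every zero-mean
integrable source `s` on `T³` and monotone `g` with `g ∘ s · s` integrable, `0 ≤ ∫ g(s x)·s x`. -/
theorem signedFamily_void_on_torus (s : 𝕋³ → ℝ) (g : ℝ → ℝ) (hg : Monotone g)
    (hs : Integrable s volume) (hgs : Integrable (fun x => g (s x) * s x) volume)
    (h0 : Torus.HasZeroMean s) : 0 ≤ ∫ x, g (s x) * s x :=
  signedFamily_void_of_free_head volume s g hg hs hgs h0

/-- **(V2) What a sub-laminar fat sequence hands to a blow-down profile.** If smooth steady states `u_n` of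
`NS_{ν_n}(f)`, `ν_n → 0`, have `E_n = ∫|u_n|² → ∞` with `ν_n²E_n → 0` AND the normalised fields
`U_n = u_n/√E_n` converge strongly in `L²` to `U` with normalised heads `Φ_n/E_n → B` (the Hoang–Jolly gap:
in 3-D no such compactness is known off the laminar rung), then dividing L2 by `√E_n` and letting `n → ∞`
leaves exactly: unit energy, nonnegative total work `(f,U) = lim ν_n‖∇u_n‖²/√E_n ≥ 0`, and the SIGNED
SUPERLEVEL WORK `∫ g(B)⟪f,U⟫ ≥ 0` for every nondecreasing nonnegative smooth weight. Recorded as the data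
predicate a 'profile rigidity' stub would have to exclude for the pinned force. -/
def HeadBlowdownData (f U : 𝕋³ → E³) (B : 𝕋³ → ℝ) : Prop :=
  (∫ x, ‖U x‖ ^ 2) = 1 ∧ 0 ≤ (∫ x, inner ℝ (f x) (U x)) ∧
    ∀ g : ℝ → ℝ, ContDiff ℝ ∞ g → Monotone g → (∀ t, 0 ≤ g t) →
      0 ≤ ∫ x, g (B x) * inner ℝ (f x) (U x)

/-- **(V2, the kill) Every INVISIBLE profile passes the blow-down data trivially (PROVED logic):** if the work
density `⟪f,U⟫` integrates to zero against every function of `B` — the case of an oblique shear profile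
`U = φ(k·x)d`, `B = φ²/2` (the `g(B)`-weighted work factors through the planar means of `f·d` on
`{k·x = ξ}`, which vanish for `k` off the support lines of `f̂`: triage F2/F3/S2/S4, re-derived here), and of a
Beltrami profile (`B ≡ const`, `(f,U) = 0`) — then `HeadBlowdownData f U B` holds. Such shear profiles exist
for EVERY force and are exactly the BN1 warm-branch skeletons; nothing in the head family separates them from
genuine blow-downs, so a rigidity stub "no profile with `HeadBlowdownData` for `f⋆`" is false as stated and its
honest repair ("… no NON-SHEAR, NON-BELTRAMI profile" + "fat sequences of `f⋆` do not blow down to shears or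
Beltrami fields") moves all difficulty into statements this idea does not touch. -/
theorem headBlowdownData_of_invisible (f U : 𝕋³ → E³) (B : 𝕋³ → ℝ)
    (hU : (∫ x, ‖U x‖ ^ 2) = 1)
    (hinv : ∀ g : ℝ → ℝ, ContDiff ℝ ∞ g → ∫ x, g (B x) * inner ℝ (f x) (U x) = 0) :
    HeadBlowdownData f U B := by
  refine ⟨hU, ?_, fun g hg _ _ => (hinv g hg).symm.le⟩
  have h1 := hinv (fun _ => (1 : ℝ)) contDiff_const
  simp only [one_mul] at h1
  exact h1.symm.le

/-- **(V3) FLOOR: smooth quiet Euler points pass every head constraint exactly (statement).** For a smooth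
forced Euler state `v` of a solenoidal force (`(v·∇)v + ∇q = f`, i.e. a head `B` of `(0, f, v)`) the
`g(B)`-weighted work vanishes for EVERY weight: `∫ g(B)⟪f,v⟫ = ∫ g(B) v·∇B = ∫ v·∇G(B) = 0` (L2's transport
form at `ν = 0`). Hence the family cannot see the quiet-branch enemy (viscous continuations `u_ν → v` inherit
the constraints with `o(1)` errors) and carries no floor mechanism. -/
def QuietEulerPointsPassHeadConstraints : Prop :=
  ∀ (f v : 𝕋³ → E³) (B : 𝕋³ → ℝ) (g : ℝ → ℝ),
    Torus.IsSmooth f → Torus.IsDivFree f → Torus.IsSmooth v → Torus.IsDivFree v →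
    IsHeadOf 0 f v B → ContDiff ℝ ∞ g →
    ∫ x, g (B x) * inner ℝ (f x) (v x) = 0

/-- PROVED bookkeeping: (V3) is literally the `ν = 0` instance of L2 — if `HeadWorkIdentity` holds then every
smooth quiet Euler point of a solenoidal force passes every head constraint. -/
theorem quietEulerPointsPass_of_headWorkIdentity (hL2 : HeadWorkIdentity) :
    QuietEulerPointsPassHeadConstraints := by
  intro f v B g hf hfd hv hvd hB hg
  have key := hL2 0 f v B g hf hfd hv hvd hB hg
  simpa using key.symm

end Summit.AnomalousDissipation.AnomalousDissipation.Cruxes.SteadyStatesLoudBounded.BernoulliHeadSignedWorkFamily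

end
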